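import Summits.ResolutionOfSingularities.ResolutionOfSingularities.Theorems.EquisingularLiftEquisingularLiftNatF102FibreTransport
import HarnessLib

/-!
# [OURS · L1 W4.5(b) · LINE (T-j)-PROOF · BRICK S5b (2)] Subsingleton fibres over the closed fibre

Setting of res-L1-w45b-lead-2's F-102 skeleton (v3): `φ : C → ℙ¹_O` over `f`, a model square `(i, t)` over `θ : O ↠ k`,
`e : C_k ≅ ℙ¹_{k'}`.  IF `e⁻¹ ≫ i ≫ φ : ℙ¹_{k'} → ℙ¹_O` pulls the standard charts back to the standard charts and its two
chart maps `Γ(ℙ¹_O, D₊(X_j)) → Γ(ℙ¹_{k'}, D₊(x_j))` are SURJECTIVE (BRICK S5b (β)), then the restriction of `e⁻¹ ≫ i ≫ φ` over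
each chart is a closed immersion of affine schemes, so `e⁻¹ ≫ i ≫ φ` is injective; and every point of `C` over the closed
point is on the special fibre, so **the fibres of `φ` over the closed fibre of `ℙ¹_O` are subsingletons** — conjunct (2) of
BRICK S5 (`subsingleton_fibres_of_chart_surjective`).  Helper for stmt-ResolutionOfSingularities-20148 (EL♮(3)) via F-102;
no new definitions.
-/

set_option linter.dupNamespace false

noncomputable section

open CategoryTheory AlgebraicGeometry HomogeneousLocalization TopologicalSpace Opposite IsLocalRing
open MvPolynomial (X C)
open Literature.AlgebraicGeometry.Morphisms Literature.AlgebraicGeometry.Motives Literature.AlgebraicGeometry.Motives.Segre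
open Literature.AlgebraicGeometry.Motives.ProjLine
open Summit.ResolutionOfSingularities.ResolutionOfSingularities.Cruxes.EquisingularLiftNat.Sections

universe u

attribute [local instance] MvPolynomial.gradedAlgebra MvPolynomial.algebraMvPolynomial
  Literature.AlgebraicGeometry.Motives.ProjBaseChange.algebraBase

namespace Summit.ResolutionOfSingularities.ResolutionOfSingularities.Cruxes.EquisingularLiftNat.F102

/-- The two standard charts cover `ℙ¹_O`. [folklore] -/
theorem ProjCech.exists_mem_basicOpen_X (O : Type u) [CommRing O] (y : ProjCech.PP O 1) :
    ∃ j : Fin 2, y ∈ Proj.basicOpen (grading (Fin 2) O) (X j) := by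
  have h := Proj.iSup_basicOpen_eq_top (grading (Fin 2) O) (fun j : Fin 2 => (X j : MvPolynomial (Fin 2) O))
    (irrelevant_le_span_X (Fin 2) O)
  have hy : y ∈ (⨆ j : Fin 2, Proj.basicOpen (grading (Fin 2) O) (X j)) := by rw [h]; trivial
  exact Opens.mem_iSup.mp hy

/-- **A morphism `ℙ¹_{k'} → ℙ¹_O` respecting the standard charts with surjective chart maps is injective.** [folklore] -/
theorem injective_of_chart_surjective (O : Type) [CommRing O] (k' : Type) [Field k']
    (g : ProjCech.PP k' 1 ⟶ ProjCech.PP O 1)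
    (hpre : ∀ j : Fin 2, g ⁻¹ᵁ Proj.basicOpen (grading (Fin 2) O) (X j) = Proj.basicOpen (A k') (X j))
    (hsurj : ∀ j : Fin 2, Function.Surjective (g.appLE (Proj.basicOpen (grading (Fin 2) O) (X j))
      (Proj.basicOpen (A k') (X j)) (hpre j).ge)) :
    Function.Injective g.base := by
  intro p p' hpp
  obtain ⟨j, hj⟩ := ProjCech.exists_mem_basicOpen_X O (g.base p)
  have hp : p ∈ Proj.basicOpen (A k') (X j) := by
    rw [← hpre j]; exact hj
  have hp' : p' ∈ Proj.basicOpen (A k') (X j) := by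
    rw [← hpre j]; change g.base p' ∈ Proj.basicOpen (grading (Fin 2) O) (X j); rw [← hpp]; exact hj
  haveI : IsAffine (Proj.basicOpen (grading (Fin 2) O) (X j) : (ProjCech.PP O 1).Opens) :=
    Proj.isAffineOpen_basicOpen (grading (Fin 2) O) (X j) (Segre.X_mem O j) zero_lt_one
  haveI : IsAffine (Proj.basicOpen (A k') (X j) : (ProjCech.PP k' 1).Opens) := isAffineOpen_basicOpen_X k' j
  set r := g.resLE (Proj.basicOpen (grading (Fin 2) O) (X j)) (Proj.basicOpen (A k') (X j)) (hpre j).ge with hr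
  haveI : IsClosedImmersion r := by
    apply IsClosedImmersion.of_surjective_of_isAffine
    change Function.Surjective (r.app ⊤)
    rw [hr, Scheme.Hom.resLE_app_top]
    dsimp only
    exact ((Proj.basicOpen (A k') (X j) : (ProjCech.PP k' 1).Opens).topIso.symm.commRingCatIsoToRingEquiv.surjective.comp
      (hsurj j)).comp (Proj.basicOpen (grading (Fin 2) O) (X j) : (ProjCech.PP O 1).Opens).topIso.commRingCatIsoToRingEquiv.surjective
  have h1 : r.base ⟨p, hp⟩ = r.base ⟨p', hp'⟩ := by
    apply (Proj.basicOpen (grading (Fin 2) O) (X j) : (ProjCech.PP O 1).Opens).ι.isOpenEmbedding.injective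
    change ((r ≫ (Proj.basicOpen (grading (Fin 2) O) (X j) : (ProjCech.PP O 1).Opens).ι).base ⟨p, hp⟩) =
      ((r ≫ (Proj.basicOpen (grading (Fin 2) O) (X j) : (ProjCech.PP O 1).Opens).ι).base ⟨p', hp'⟩)
    rw [hr, Scheme.Hom.resLE_comp_ι]
    exact hpp
  have h2 := r.isClosedEmbedding.injective h1
  exact congrArg Subtype.val h2

/-- **BRICK S5b, conjunct (2): the fibres of `φ` over the closed fibre are subsingletons.** [OURS] -/
theorem subsingleton_fibres_of_chart_surjective (O : Type) [CommRing O] [IsLocalRing O] (k : Type) [Field k]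
    (θ : O →+* k) (hθ : Function.Surjective θ) {C Ck : Scheme.{0}} (f : C ⟶ Spec (.of O)) (i : Ck ⟶ C)
    (t : Ck ⟶ Spec (.of k)) (hsq : IsPullback i t f (Spec.map (CommRingCat.ofHom θ))) (k' : Type) [Field k']
    (e : Ck ≅ ProjCech.PP k' 1) (φ : C ⟶ ProjCech.PP O 1) (hφ : φ ≫ ProjCech.toSpec O 1 = f)
    (hpre : ∀ j : Fin 2, (e.inv ≫ i ≫ φ) ⁻¹ᵁ Proj.basicOpen (grading (Fin 2) O) (X j) = Proj.basicOpen (A k') (X j))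
    (hsurj : ∀ j : Fin 2, Function.Surjective ((e.inv ≫ i ≫ φ).appLE (Proj.basicOpen (grading (Fin 2) O) (X j))
      (Proj.basicOpen (A k') (X j)) (hpre j).ge)) :
    ∀ y : ProjCech.PP O 1, ProjCech.toSpec O 1 y = closedPoint O → (φ.base ⁻¹' {y}).Subsingleton := by
  intro y hy x hx x' hx'
  have hinj := injective_of_chart_surjective O k' (e.inv ≫ i ≫ φ) hpre hsurj
  have hrange : ∀ x : C, φ.base x = y → ∃ p, (e.inv ≫ i).base p = x := fun x hx => by
    have hfx : f.base x = closedPoint O := by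
      rw [← hφ]; change (ProjCech.toSpec O 1).base (φ.base x) = _; rw [hx]; exact hy
    have hxr : x ∈ f.base ⁻¹' Set.range (Spec.map (CommRingCat.ofHom θ)).base := by
      rw [range_specMap_of_surjective_of_field θ hθ]; exact hfx
    rw [← range_eq_preimage_of_isPullback hsq] at hxr
    obtain ⟨z, rfl⟩ := hxr
    refine ⟨e.hom.base z, ?_⟩
    change i.base ((e.hom ≫ e.inv).base z) = i.base z
    rw [e.hom_inv_id]; rfl
  obtain ⟨p, rfl⟩ := hrange x hx
  obtain ⟨p', rfl⟩ := hrange x' hx'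
  have h : (e.inv ≫ i ≫ φ).base p = (e.inv ≫ i ≫ φ).base p' := by
    change φ.base (i.base (e.inv.base p)) = φ.base (i.base (e.inv.base p'))
    have hx1 : φ.base (i.base (e.inv.base p)) = y := hx
    have hx2 : φ.base (i.base (e.inv.base p')) = y := hx'
    rw [hx1, hx2]
  rw [hinj h]

end Summit.ResolutionOfSingularities.ResolutionOfSingularities.Cruxes.EquisingularLiftNat.F102

end
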